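import Summits.ABC.IUTFork.Cor312Steps
import Summits.ABC.IUTFork.Cor312Statement
import HarnessLib

/-!
# [IUTchIII] Corollary 3.12, proof Steps (vi)–(ix), over the real definitions (TEAM A, row A-5 slice 2)

Record-only file (D-0012) of the abc-iut cell (Cor. 3.12 strategy TEAM A «direct III§3», seat
abc-iut-c312-10 = A2; row **A-5 slice 2** of `HOME/plan/C312-TEAMS.md`, taken 23:32:15Z after the
23:17:22Z offer to skel lapsed by action); TAKES NO SIDE. Companion to `Cor312StepsIviReal.lean`
(slice 1) and the A-1/A-2/A-3/A-4 files: it discharges the proof nodes **Steps (vi), (vii), (viii),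
(ix)** of [IUTchIII] Cor. 3.12 (kurims text `paper:url-4b091feeb646`, p. 177 l. 35 – p. 180 l. 42;
`Cor312Proof.Step.vi/vii/viii/ix`) as kernel inferences over the frozen definitions.

DESIGN (the A-5 row's no-inflation note applies with full force here): these four nodes are
PROVENANCE and METHOD summaries — they recall WHERE the log-Kummer correspondences, the conjugate
synchronization, the three cyclotomic-rigidity approaches, the two symmetries and the `F_mod`
translation apparatus come from. Their kernel content lives entirely in the cited loci (typed by
c312-1's A–L, the L2/L4/L6 layers); the honest readings are therefore loci-wired PASS-THROUGHS (each
wiring hypothesis names the exact locus the printed sentence cites), with NO new mathematical claim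
manufactured here. The one piece of outright kernel content this file adds is a CITATION CENSUS by
`decide` over the landed DAG (`Cor312Steps`):

* **PIN LOCALIZATION** — the two OPEN L4 proof-chain pins (plan/C312-RESIDUALS.md §2:
  `absTopIII_prop3_2_iv` = [AbsTopIII] Prop. 3.2 (iv), owner L4-t2, and `absAnab_prop1_2_1_vii` =
  [AbsAnab] Prop. 1.2.1 (vii), owner L4-t4) are cited by NO node of the twenty other than **Step (vi)**
  (`absTopIII_pin_only_at_vi`, `absAnab_pin_only_at_vi`), and `etTh` is cited only at (ii), (vi),
  (xi-h) (`etTh_cited_only_at`). Consequence for the overnight adjudication: while those two pins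
  remain open, exactly the Step (vi) inference (and through it the chain) is conditioned on them —
  kernel-checked, not estimated.

The observations (verbatim cores as recorded in `Cor312Obs.lean`, verified on this seat's renders):

* `Obs.logKummerViaGaloisEvaluation` ((vi), p. 177 l. 35–44: the log-Kummer correspondences (ii) (b),
  (c) "are obtained precisely as a consequence of the splittings, up to roots of unity, … constructed
  by applying the **Galois evaluation** operations"; the Kummer theory of local LGP-monoids "depends,
  in an essential way, on … [IUTchII], §3 … which, in turn, depends … on … [EtTh]"). Pass-through
  `CGalEval`, wired from the two dependency loci the sentence names: `chII_sec3_cor3_5_3_6`, `etTh`.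
* `Obs.conjSyncLogLinkCompatible` ((vi), p. 178 l. 12–16: "it is precisely by establishing this
  **conjugate synchronization** arising from the `F^{⋊±}_l`-symmetry … that one is able to conclude the
  crucial **compatibility of this conjugate synchronization with the log-link**"). Pass-through
  `CConjSync`, wired from the synchronization locus `chII_prop4_2_i` ([IUTchII] Prop. 4.2 (i)).
* `Obs.cycRigidityApproaches` ((vi), p. 178 l. 17 – p. 179 l. 5 + Fig. 3.7: the three approaches to
  **cyclotomic rigidity** — mono-theta (multiradial), MLF-Galois pairs (uniradial), number fields via
  `ℚ_{>0} ∩ Ẑ^× = {1}` (multiradial) — "are **mutually compatible** in the sense that they yield the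
  same cyclotomic rigidity isomorphism in any setting in which more than one … may be applied").
  Reading `StepMid.CycRigThree` := the conjunction of four parameters wired from the approaches' own
  loci: `CMono` ← `etTh`, `CMLF` ← `absTopIII_prop3_2_iv` (OPEN pin, L4-t2), `CNF` ←
  `absAnab_prop1_2_1_vii` (OPEN pin, L4-t4), `CCompat` ← `chII_rem3_6_4` (the compatibility
  discussion) — the reading makes the two open pins' load-bearing role explicit.
* `Obs.symmetriesSeparate` ((vii), p. 179 l. 19–38: the bi-coricity depends on the `F^{⋊±}_l` conjugate
  synchronization, "fundamentally incompatible with the `F^⋇_l`-symmetry, [so] it is necessary to work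
  with these two symmetries **separately**"; the `F^⋇_l`-symmetry "allows one to "descend to `F_mod`"").
  Pass-through `CSep`, wired from the construction locus `chI_sec4_5_6` ([IUTchI] §4–6).
* `Obs.symmetriesMultiradial` ((vii), p. 179 l. 38 – p. 180 l. 10: both symmetries "compatible with the
  vertical coricity and relevant Kummer isomorphisms … give rise to **multiradial structures** via the
  **tautological approach** … discussed in Remark 3.11.2, (i), (ii)"). Pass-through `CTaut`, wired from
  `rem3_11_2`.
* `Obs.conjugacyIndetResolved` ((viii), p. 180 l. 11–20: the global ±-synchronizations "give rise to
  **profinite conjugacy indeterminacies** … which are **resolved by applying the theory of [IUTchI],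
  §2**"). Pass-through `CConjRes`, wired from `chI_sec2`.
* `Obs.fmodTranslation` ((ix), p. 180 l. 21–42: "the ring structure of the global field `F_mod` …
  furnishes a **translation apparatus**"; `F^⊛_MOD` "better suited to describing the relation to the
  Θ^{×μ}_{LGP}-link", `F^⊛_mod` "to explicit estimates"). Pass-through `CFmod`, wired from
  `rem3_10_1` and `Ind3` (the two loci (ix) cites); the typed shadow of the MOD/mod pair is c312-1's
  `GlobalDegrees` (both object classes with the natural identification), carried by the frozen
  `Situation` — data, nothing to prove.

`Cor312Proof.stepVI_holds` / `stepVII_holds` / `stepVIII_holds` / `stepIX_holds` prove the four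
`Step.Holds` under any reading wired to these contents. With slices 1 (wlog, (i)–(v), p411659), A-1
((x), p411096), A-2 ((xi-a)–(xi-c), p411416), A-3 ((xi-d)–(xi-e), c312-4 p411129) and A-4's
(xi-f)-chain file (A1 p411441), every node of the twenty-step chain except the (xi-g)/(xi-h)/(xii)
tail has a per-step Holds file over the real definitions.

Sources read on the page (this seat's renders): pp. 177–180. [claim: Mochizuki2012, status: disputed]
Deliberately NOT here: the loci contents themselves (typed by c312-1 A–L, L2/L4/L6; the two OPEN pins
are L4-t2/L4-t4's rows); the (xi-f) edge and the global GapA (A-4/skel XXIV); any judgement.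
-/

noncomputable section

namespace Summit.ABC

namespace IUTFork

namespace StepMid

open Cor312Proof

/-! ## 1. Pin localization (kernel census by `decide` over the landed DAG) -/

/-- **PIN LOCALIZATION, [AbsTopIII] Prop. 3.2 (iv)** (OPEN proof-chain pin, owner L4-t2): among the
twenty nodes, only Step (vi) cites it — while the pin is open, exactly the (vi) inference is
conditioned on it. [folklore] -/
theorem absTopIII_pin_only_at_vi :
    ∀ s ∈ Step.all, Locus.absTopIII_prop3_2_iv ∈ s.cites → s = Step.vi := by decide

/-- **PIN LOCALIZATION, [AbsAnab] Prop. 1.2.1 (vii)** (OPEN proof-chain pin, owner L4-t4): among the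
twenty nodes, only Step (vi) cites it. [folklore] -/
theorem absAnab_pin_only_at_vi :
    ∀ s ∈ Step.all, Locus.absAnab_prop1_2_1_vii ∈ s.cites → s = Step.vi := by decide

/-- `etTh` (the [EtTh] dependency) is cited exactly at Steps (ii), (vi), (xi-h) — the census behind
(xi-h)'s "the argument depends on [EtTh]". [folklore] -/
theorem etTh_cited_only_at :
    ∀ s ∈ Step.all, Locus.etTh ∈ s.cites → s = Step.ii ∨ s = Step.vi ∨ s = Step.xi_h := by decide

/-- The same three censuses for the ref-corrected citation datum `Step.cites'` (PASS-R7 F5): the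
corrected datum moves no pin. [folklore] -/
theorem pins_cites' :
    (∀ s ∈ Step.all, Locus.absTopIII_prop3_2_iv ∈ s.cites' → s = Step.vi) ∧
      (∀ s ∈ Step.all, Locus.absAnab_prop1_2_1_vii ∈ s.cites' → s = Step.vi) ∧
      ∀ s ∈ Step.all, Locus.etTh ∈ s.cites' → s = Step.ii ∨ s = Step.vi ∨ s = Step.xi_h := by
  refine ⟨?_, ?_, ?_⟩ <;> decide

/-! ## 2. The one named reading: the three cyclotomic-rigidity approaches -/

/-- READING of `Obs.cycRigidityApproaches` ((vi), p. 178 l. 17 – p. 179 l. 5): the three approaches'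
contents and their mutual compatibility, as the conjunction of four parameters wired from the
approaches' own loci (`etTh` mono-theta · `absTopIII_prop3_2_iv` MLF-Galois pairs, OPEN pin ·
`absAnab_prop1_2_1_vii` number fields via `ℚ_{>0} ∩ Ẑ^× = {1}`, OPEN pin · `chII_rem3_6_4` mutual
compatibility). [claim: Mochizuki2012, status: disputed] -/
@[claim "Mochizuki2012" "disputed"] def CycRigThree (CMono CMLF CNF CCompat : Prop) : Prop :=
  CMono ∧ CMLF ∧ CNF ∧ CCompat

end StepMid

/-! ## 3. The four nodes as inferences -/

namespace Cor312Proof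

open StepMid

/-- **Step (vi) HOLDS** under any reading wired to the three contents — all pass-throughs of the loci
the printed sentences cite (module docstring); the invoked Step (v) observation is not needed for the
conclusions as read. [claim: Mochizuki2012, status: disputed] -/
theorem stepVI_holds {L : Locus → Prop} {O : Obs → Prop}
    {CGalEval CConjSync CMono CMLF CNF CCompat : Prop}
    (hG : L .chII_sec3_cor3_5_3_6 → L .etTh → CGalEval)
    (hC : L .chII_prop4_2_i → CConjSync)
    (hM : L .etTh → CMono) (hF : L .absTopIII_prop3_2_iv → CMLF)
    (hN : L .absAnab_prop1_2_1_vii → CNF) (hK : L .chII_rem3_6_4 → CCompat)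
    (hO1 : CGalEval → O .logKummerViaGaloisEvaluation)
    (hO2 : CConjSync → O .conjSyncLogLinkCompatible)
    (hO3 : CycRigThree CMono CMLF CNF CCompat → O .cycRigidityApproaches) :
    Step.vi.Holds L O := by
  intro hc _hu o ho
  have ho' : o = Obs.logKummerViaGaloisEvaluation ∨ o = Obs.conjSyncLogLinkCompatible ∨
      o = Obs.cycRigidityApproaches := by simpa [Step.concl, Step.data] using ho
  rcases ho' with rfl | rfl | rfl
  · exact hO1 (hG (hc _ (by decide)) (hc _ (by decide)))
  · exact hO2 (hC (hc _ (by decide)))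
  · exact hO3 ⟨hM (hc _ (by decide)), hF (hc _ (by decide)), hN (hc _ (by decide)),
      hK (hc _ (by decide))⟩

/-- **Step (vii) HOLDS** under any reading wired to the two contents (pass-throughs of `chI_sec4_5_6`
resp. `rem3_11_2`). [claim: Mochizuki2012, status: disputed] -/
theorem stepVII_holds {L : Locus → Prop} {O : Obs → Prop} {CSep CTaut : Prop}
    (hS : L .chI_sec4_5_6 → CSep) (hT : L .rem3_11_2 → CTaut)
    (hO1 : CSep → O .symmetriesSeparate) (hO2 : CTaut → O .symmetriesMultiradial) :
    Step.vii.Holds L O := by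
  intro hc _hu o ho
  have ho' : o = Obs.symmetriesSeparate ∨ o = Obs.symmetriesMultiradial := by
    simpa [Step.concl, Step.data] using ho
  rcases ho' with rfl | rfl
  · exact hO1 (hS (hc _ (by decide)))
  · exact hO2 (hT (hc _ (by decide)))

/-- **Step (viii) HOLDS** under any reading wired to the resolution content (pass-through of
`chI_sec2` — "resolved by applying the theory of [IUTchI], §2").
[claim: Mochizuki2012, status: disputed] -/
theorem stepVIII_holds {L : Locus → Prop} {O : Obs → Prop} {CConjRes : Prop}
    (hR : L .chI_sec2 → CConjRes)
    (hO : CConjRes → O .conjugacyIndetResolved) : Step.viii.Holds L O := by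
  intro hc _hu o ho
  have ho' : o = Obs.conjugacyIndetResolved := by simpa [Step.concl, Step.data] using ho
  subst ho'
  exact hO (hR (hc _ (by decide)))

/-- **Step (ix) HOLDS** under any reading wired to the translation content (pass-through of
`rem3_10_1` and `Ind3`, the two loci (ix) cites; the MOD/mod pair's typed shadow is the frozen
`GlobalDegrees` data). [claim: Mochizuki2012, status: disputed] -/
theorem stepIX_holds {L : Locus → Prop} {O : Obs → Prop} {CFmod : Prop}
    (hF : L .rem3_10_1 → L .Ind3 → CFmod)
    (hO : CFmod → O .fmodTranslation) : Step.ix.Holds L O := by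
  intro hc _hu o ho
  have ho' : o = Obs.fmodTranslation := by simpa [Step.concl, Step.data] using ho
  subst ho'
  exact hO (hF (hc _ (by decide)) (hc _ (by decide)))

end Cor312Proof

end IUTFork

end Summit.ABC

end
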